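import Mathlib.Analysis.Normed.Group.Constructions
import Mathlib.Analysis.Normed.Group.Real
import Mathlib.Algebra.Order.Floor.Ring

/-!
# Every sup-ball of radius `1/16` in `ℝ³` sits inside one Kuhn star
(stub `stub_goodCentre` of line `mtp-prestress-split-ergodic-frame`,
crux `LayeredLawsSelectHcp`, stmt-AtomisticToContinuum-9226)

For every `x₀ : ℝ × ℝ × ℝ` there are an integer point `m` and a threshold `τ ∈ [0,1]` with
`τ − 1 ≤ x_j − m_j ≤ τ` (`j = 1,2,3`) for all `x` with `‖x − x₀‖ ≤ 1/16` (sup norm of the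
product).  This is the "Lebesgue number" statement for the stars of the Kuhn–Freudenthal
subdivision used by the threshold interpolant `G x = ∫₀¹ Y ⌈x − t(1,1,1)⌉ dt`.

Proof.  Take the candidates `τ = i/8`, `i = 0,…,7`, and for a coordinate value `s` call `i`
*good* if `1/16 ≤ fract (s − i/8) ≤ 15/16`; then `m := ⌊s − i/8⌋ + 1` gives
`s − m = i/8 − 1 + fract (s − i/8) ∈ [i/8 − 1 + 1/16, i/8 − 1/16]`, which absorbs the slack
`± 1/16` (`goodCentre_coord`).  A bad `i` puts `s − i/8` within `1/16` of an integer, and two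
candidates are `1/8` apart modulo `1`, so each coordinate has at most one bad candidate
(`goodCentre_sep`); three coordinates exclude at most three of the eight candidates
(`goodCentre_pigeonhole`).  All `[folklore]`.
-/

noncomputable section

namespace Summit.AtomisticToContinuum.Crystallization.Theorems.PalmUnimodularRigidity.LayeredLawsSelectHcp

/-- One coordinate of the good-centre lemma: if `1/16 ≤ fract (s − τ) ≤ 15/16` then
`m := ⌊s − τ⌋ + 1` satisfies `τ − 1 ≤ y − m ≤ τ` for every `y` with `|y − s| ≤ 1/16`.
[folklore] -/
theorem goodCentre_coord {s τ y : ℝ} (h₁ : 1 / 16 ≤ Int.fract (s - τ))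
    (h₂ : Int.fract (s - τ) ≤ 15 / 16) (hy : |y - s| ≤ 1 / 16) :
    τ - 1 ≤ y - ((⌊s - τ⌋ + 1 : ℤ) : ℝ) ∧ y - ((⌊s - τ⌋ + 1 : ℤ) : ℝ) ≤ τ := by
  rw [← Int.self_sub_floor] at h₁ h₂
  rw [abs_le] at hy
  push_cast
  constructor <;> linarith

/-- Separation of the candidates `τ = i/8`: for a fixed real `s`, at most one `i < 8` violates
`1/16 ≤ fract (s − i/8) ≤ 15/16` (a violation puts `s − i/8` within `1/16` of an integer, and
two distinct candidates differ by a non-integer multiple of `1/8`). [folklore] -/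
theorem goodCentre_sep (s : ℝ) : ∀ i j : ℕ, i < 8 → j < 8 →
    ¬ (1 / 16 ≤ Int.fract (s - i / 8) ∧ Int.fract (s - i / 8) ≤ 15 / 16) →
    ¬ (1 / 16 ≤ Int.fract (s - j / 8) ∧ Int.fract (s - j / 8) ≤ 15 / 16) → i = j := by
  -- a bad candidate is within `1/16` of an integer translate
  have key : ∀ t : ℝ, ¬ (1 / 16 ≤ Int.fract t ∧ Int.fract t ≤ 15 / 16) →
      ∃ n : ℤ, -(1 / 16) < t - n ∧ t - n < 1 / 16 := by
    intro t ht
    have h0 := Int.fract_nonneg t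
    have h1 := Int.fract_lt_one t
    rw [← Int.self_sub_floor] at ht h0 h1
    rcases not_and_or.1 ht with ht | ht
    · exact ⟨⌊t⌋, by linarith, by linarith [not_le.1 ht]⟩
    · exact ⟨⌊t⌋ + 1, by push_cast; linarith [not_le.1 ht], by push_cast; linarith⟩
  intro i j hi hj hbi hbj
  obtain ⟨n, hn₁, hn₂⟩ := key _ hbi
  obtain ⟨n', hn'₁, hn'₂⟩ := key _ hbj
  have hlt : (j : ℤ) - (i : ℤ) + 8 * (n' - n) < 1 := by
    have : (j : ℝ) - (i : ℝ) + 8 * ((n' : ℝ) - (n : ℝ)) < 1 := by linarith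
    exact_mod_cast this
  have hgt : (-1 : ℤ) < (j : ℤ) - (i : ℤ) + 8 * (n' - n) := by
    have : (-1 : ℝ) < (j : ℝ) - (i : ℝ) + 8 * ((n' : ℝ) - (n : ℝ)) := by linarith
    exact_mod_cast this
  omega

/-- Pigeonhole for the eight candidates: if each of three predicates on `ℕ` fails at no two
distinct indices below `8`, some index below `8` satisfies all three. [folklore] -/
theorem goodCentre_pigeonhole {Pa Pb Pc : ℕ → Prop}
    (ha : ∀ i j : ℕ, i < 8 → j < 8 → ¬ Pa i → ¬ Pa j → i = j)
    (hb : ∀ i j : ℕ, i < 8 → j < 8 → ¬ Pb i → ¬ Pb j → i = j)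
    (hc : ∀ i j : ℕ, i < 8 → j < 8 → ¬ Pc i → ¬ Pc j → i = j) :
    ∃ i : ℕ, i < 8 ∧ Pa i ∧ Pb i ∧ Pc i := by
  classical
  -- each predicate holds below `8` away from one exceptional index
  have hex : ∀ {P : ℕ → Prop}, (∀ i j : ℕ, i < 8 → j < 8 → ¬ P i → ¬ P j → i = j) →
      ∃ e : ℕ, ∀ i, i < 8 → i ≠ e → P i := by
    intro P hP
    by_cases h : ∃ j, j < 8 ∧ ¬ P j
    · obtain ⟨j, hj, hPj⟩ := h
      exact ⟨j, fun i hi hij => by_contra fun hPi => hij (hP i j hi hj hPi hPj)⟩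
    · push Not at h
      exact ⟨8, fun i hi _ => h i hi⟩
  obtain ⟨a, hA⟩ := hex ha
  obtain ⟨b, hB⟩ := hex hb
  obtain ⟨c, hC⟩ := hex hc
  -- among `0, 1, 2, 3` some index avoids the three exceptional ones
  obtain ⟨i, hi, hia, hib, hic⟩ : ∃ i : ℕ, i < 8 ∧ i ≠ a ∧ i ≠ b ∧ i ≠ c := by
    by_cases h0 : 0 ≠ a ∧ 0 ≠ b ∧ 0 ≠ c
    · exact ⟨0, by norm_num, h0⟩
    by_cases h1 : 1 ≠ a ∧ 1 ≠ b ∧ 1 ≠ c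
    · exact ⟨1, by norm_num, h1⟩
    by_cases h2 : 2 ≠ a ∧ 2 ≠ b ∧ 2 ≠ c
    · exact ⟨2, by norm_num, h2⟩
    exact ⟨3, by norm_num, by omega⟩
  exact ⟨i, hi, hA i hi hia, hB i hi hib, hC i hi hic⟩

/-- **Good centres (stub `stub_goodCentre`).**  Every sup-ball of radius `1/16` in `ℝ × ℝ × ℝ`
sits inside one Kuhn star: for every `x₀` there are `m : ℤ × ℤ × ℤ` and `τ ∈ [0,1]` with
`τ − 1 ≤ x_j − m_j ≤ τ` for `j = 1,2,3` and all `x` with `‖x − x₀‖ ≤ 1/16`. [folklore] -/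
theorem stub_goodCentre :
    ∀ x₀ : ℝ × ℝ × ℝ, ∃ m : ℤ × ℤ × ℤ, ∃ τ : ℝ, 0 ≤ τ ∧ τ ≤ 1 ∧
      ∀ x : ℝ × ℝ × ℝ, ‖x - x₀‖ ≤ 1 / 16 →
        (τ - 1 ≤ x.1 - m.1 ∧ x.1 - m.1 ≤ τ) ∧ (τ - 1 ≤ x.2.1 - m.2.1 ∧ x.2.1 - m.2.1 ≤ τ) ∧
          (τ - 1 ≤ x.2.2 - m.2.2 ∧ x.2.2 - m.2.2 ≤ τ) := by
  intro x₀
  obtain ⟨i, hi, ha, hb, hc⟩ :=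
    goodCentre_pigeonhole (goodCentre_sep x₀.1) (goodCentre_sep x₀.2.1) (goodCentre_sep x₀.2.2)
  refine ⟨(⌊x₀.1 - i / 8⌋ + 1, ⌊x₀.2.1 - i / 8⌋ + 1, ⌊x₀.2.2 - i / 8⌋ + 1), i / 8,
    by positivity, ?_, fun x hx => ?_⟩
  · have h7 : (i : ℝ) ≤ 7 := by exact_mod_cast Nat.lt_succ_iff.1 hi
    linarith
  · obtain ⟨h₁, h₂₃⟩ := norm_prod_le_iff.1 hx
    obtain ⟨h₂, h₃⟩ := norm_prod_le_iff.1 h₂₃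
    simp only [Prod.fst_sub, Prod.snd_sub, Real.norm_eq_abs] at h₁ h₂ h₃
    exact ⟨goodCentre_coord ha.1 ha.2 h₁, goodCentre_coord hb.1 hb.2 h₂,
      goodCentre_coord hc.1 hc.2 h₃⟩

end Summit.AtomisticToContinuum.Crystallization.Theorems.PalmUnimodularRigidity.LayeredLawsSelectHcp
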